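import Summits.NavierStokesRegularity.NavierStokesRegularity.Theorems.TypeILiouvilleTypeIliouvilleLWeakL3VanishingTail
import HarnessLib

/-!
# S3ʷ implies the REGISTERED persistent stub S3ᵐ of crux `TypeIliouvilleL`
# (stmt-NavierStokesRegularity-10661) — statement shape verbatim

Helper file (theorems only, no definition, no named fact, no `sorry`; lands
`--supports stmt-NavierStokesRegularity-10661`; LAND-ONLY, no skeleton touched). The registered stub
`stub_persistent_mild_backward_L3_recurrence` (S3ᵐ, `Cruxes/TypeIliouvilleL/Lines/birth.lean`)
concludes, for every persistent member `v` of print's class P,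
`∃ (b : ℕ → ℝ³) (τ : ℕ → ℝ) (M : ℝ≥0), (∀ k, τ k < 0) ∧ τ → −∞ ∧ ∀ k, ‖v(τ_k) − b_k‖_{L³} ≤ M`.
Here: the weak-`L³` / vanishing-tail hypothesis S3ʷ (ONE constant, uniform weak-`L³` bound along
`τ_k → −∞`, vanishing lower tail at ONE index) implies that conclusion VERBATIM for the same `v` —
because S3ʷ already forces `v ≡ b` (`oseenMild_const_of_backward_weakL3_const_of_tail`), after which
constants recur trivially. So a proof of S3ʷ for persistent members closes the registered stub by
`persistentL3Recurrence_of_weakL3TailRecurrence`. Nothing here proves S3ᵐ, S3ʷ, (L), or anything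
about Navier–Stokes regularity.
-/

set_option linter.dupNamespace false

namespace Summit.NavierStokesRegularity.NavierStokesRegularity.Theorems

open MeasureTheory Filter Set Function Metric
open scoped ENNReal NNReal Topology
open Literature.Analysis Literature.Analysis.FluidPDE

/-- **S3ʷ data for `v` ⇒ the registered S3ᵐ conclusion for `v`.** Let `v` be in print's class P
(continuous and uniformly bounded on `(−∞,0) × ℝ³`, weakly divergence free, Oseen-mild). If there
are ONE constant `b`, negative times `τ_k → −∞`, a finite `M` with
`s³·vol{s < ‖v(τ_k) − b‖} ≤ M` (`s > 0`, all `k`) and an index `k₀` with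
`s³·vol{s < ‖v(τ_{k₀}) − b‖} → 0` as `s → 0⁺`, then
`∃ (b' : ℕ → ℝ³) (τ' : ℕ → ℝ) (M' : ℝ≥0), (∀ k, τ' k < 0) ∧ τ' → −∞ ∧ ∀ k, ‖v(τ'_k) − b'_k‖_{L³} ≤ M'`
— the conclusion of `stub_persistent_mild_backward_L3_recurrence` verbatim (`v ≡ b` by
`oseenMild_const_of_backward_weakL3_const_of_tail`; then `b'_k = b`, `τ'_k = −(k+1)`, `M' = 0`).
[cite: AlbrittonBarker2019, Thm 4.1 (arXiv:1811.00502 §4 p. 9)] -/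
theorem persistentL3Recurrence_of_weakL3TailRecurrence
    (v : ℝ → EuclideanSpace ℝ (Fin 3) → EuclideanSpace ℝ (Fin 3))
    (hvc : ContinuousOn (uncurry v) (Iio 0 ×ˢ univ))
    (hvK : ∃ K : ℝ, ∀ t < 0, ∀ x, ‖v t x‖ ≤ K)
    (hvd : ∀ t < 0, IsWeaklyDivFree (v t))
    (hvm : ∀ s t : ℝ, s < t → t < 0 → ∀ x,
      v t x = UnboundedOperators.heatExtension (v s) (t - s) x - oseenDuhamel 1 s v v t x)
    (hS3w : ∃ (b : EuclideanSpace ℝ (Fin 3)) (τ : ℕ → ℝ) (M : ℝ≥0) (k₀ : ℕ),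
      (∀ k, τ k < 0) ∧ Tendsto τ atTop atBot ∧
      (∀ (k : ℕ) (s : ℝ), 0 < s →
        ENNReal.ofReal s ^ 3 *
          (volume : Measure (EuclideanSpace ℝ (Fin 3))) {x | s < ‖v (τ k) x - b‖} ≤ (M : ℝ≥0∞)) ∧
      Tendsto (fun s : ℝ => ENNReal.ofReal s ^ 3 *
          (volume : Measure (EuclideanSpace ℝ (Fin 3))) {x | s < ‖v (τ k₀) x - b‖})
        (𝓝[>] 0) (𝓝 0)) :
    ∃ (b : ℕ → EuclideanSpace ℝ (Fin 3)) (τ : ℕ → ℝ) (M : NNReal),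
      (∀ k, τ k < 0) ∧ Tendsto τ atTop atBot ∧
      ∀ k, eLpNorm (fun x => v (τ k) x - b k) 3
        (volume : Measure (EuclideanSpace ℝ (Fin 3))) ≤ (M : ENNReal) := by
  obtain ⟨b, τ, M, k₀, hτ0, hτ, hwk, htail⟩ := hS3w
  have hconst : ∀ t < 0, ∀ x, v t x = b :=
    oseenMild_const_of_backward_weakL3_const_of_tail v b hvc hvK hvd hvm (M := (M : ℝ≥0∞))
      ENNReal.coe_lt_top hτ hτ0 hwk (k₀ := k₀) htail
  refine ⟨fun _ => b, τ, 0, hτ0, hτ, fun k => ?_⟩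
  have hzero : (fun x => v (τ k) x - b) = fun _ => (0 : EuclideanSpace ℝ (Fin 3)) := by
    funext x
    rw [hconst (τ k) (hτ0 k) x, sub_self]
  rw [hzero]
  simp

/-- **Hence: S3ʷ (as a statement about all persistent members of P) implies the registered stub S3ᵐ
as stated** (both quantify over the same class with the same persistence hypothesis
`¬ ∃ C, ‖v(t,x)‖ ≤ C/√(−t)`). [cite: AlbrittonBarker2019, Thm 4.1 (arXiv:1811.00502 §4 p. 9)] -/
theorem stubS3m_statement_of_weakL3TailRecurrence
    (hS3w : ∀ v : ℝ → EuclideanSpace ℝ (Fin 3) → EuclideanSpace ℝ (Fin 3),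
      ContinuousOn (uncurry v) (Iio 0 ×ˢ univ) →
      (∃ K : ℝ, ∀ t < 0, ∀ x, ‖v t x‖ ≤ K) →
      (∀ t < 0, IsWeaklyDivFree (v t)) →
      (∀ s t : ℝ, s < t → t < 0 → ∀ x,
        v t x = UnboundedOperators.heatExtension (v s) (t - s) x - oseenDuhamel 1 s v v t x) →
      (¬ ∃ C : ℝ, ∀ t < 0, ∀ x, ‖v t x‖ ≤ C / Real.sqrt (-t)) →
      ∃ (b : EuclideanSpace ℝ (Fin 3)) (τ : ℕ → ℝ) (M : ℝ≥0) (k₀ : ℕ),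
        (∀ k, τ k < 0) ∧ Tendsto τ atTop atBot ∧
        (∀ (k : ℕ) (s : ℝ), 0 < s →
          ENNReal.ofReal s ^ 3 *
            (volume : Measure (EuclideanSpace ℝ (Fin 3))) {x | s < ‖v (τ k) x - b‖} ≤ (M : ℝ≥0∞)) ∧
        Tendsto (fun s : ℝ => ENNReal.ofReal s ^ 3 *
            (volume : Measure (EuclideanSpace ℝ (Fin 3))) {x | s < ‖v (τ k₀) x - b‖})
          (𝓝[>] 0) (𝓝 0)) :
    ∀ v : ℝ → EuclideanSpace ℝ (Fin 3) → EuclideanSpace ℝ (Fin 3),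
      ContinuousOn (uncurry v) (Iio 0 ×ˢ univ) →
      (∃ K : ℝ, ∀ t < 0, ∀ x, ‖v t x‖ ≤ K) →
      (∀ t < 0, IsWeaklyDivFree (v t)) →
      (∀ s t : ℝ, s < t → t < 0 → ∀ x,
        v t x = UnboundedOperators.heatExtension (v s) (t - s) x - oseenDuhamel 1 s v v t x) →
      (¬ ∃ C : ℝ, ∀ t < 0, ∀ x, ‖v t x‖ ≤ C / Real.sqrt (-t)) →
      ∃ (b : ℕ → EuclideanSpace ℝ (Fin 3)) (τ : ℕ → ℝ) (M : NNReal),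
        (∀ k, τ k < 0) ∧ Tendsto τ atTop atBot ∧
        ∀ k, eLpNorm (fun x => v (τ k) x - b k) 3
          (volume : Measure (EuclideanSpace ℝ (Fin 3))) ≤ (M : ENNReal) :=
  fun v hvc hvK hvd hvm hpers =>
    persistentL3Recurrence_of_weakL3TailRecurrence v hvc hvK hvd hvm (hS3w v hvc hvK hvd hvm hpers)

end Summit.NavierStokesRegularity.NavierStokesRegularity.Theorems
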